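import Summits.ValiantsHypothesis.ValiantsHypothesis.Theorems.LacunarySymmetroidMatrixDescartesCensusV19SCheck

/-!
# `MatrixDescartes` census — splitting a `V19S.checkCells` slice into pieces (kernel memory budget)

HONEST FRAMING.  Object-search cell `pub-symmetroid`; door-A item `DoorA26 = PosRootLawAt 2 6 19` (stmt-ValiantsHypothesis-19979; OPEN, typed, never asserted).
Bookkeeping only (val-sym-door-p4 g5): `V19S.checkCells d (L₁ ++ L₂) (c₁ ++ c₂)` follows from the two halves, so a data file may replay a heavy slice of cells in
several `decide +kernel` pieces (the kernel's memory budget is per declaration) and still state the slice in the shape `V19S.posRootLawOn_of_slices8` consumes.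
Nothing here bears on `ζ_sym(2,6)`, on `DoorA26`, on `MatrixDescartes` (stmt-ValiantsHypothesis-18050) or on `VP ≠ VNP`.

[folklore] Bookkeeping; elementary.
-/

-- the D-0017 layout repeats a namespace component (single-conjunct summit); the `dupNamespace` linter flags it; name mandated.
set_option linter.dupNamespace false

namespace Summit.ValiantsHypothesis.ValiantsHypothesis.Theorems.LacunarySymmetroidMatrixDescartes.Census.V19S

open V20 (Atom sortAtoms ordOK)

/-- `cellsOK` over concatenated lists of equal-length pieces. [folklore] -/
theorem cellsOK_append (d : List ℕ) (ord : List Atom) :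
    ∀ (L₁ : List (Bool × Mode)) (c₁ : List Cert) (L₂ : List (Bool × Mode)) (c₂ : List Cert), L₁.length = c₁.length →
      cellsOK d ord L₁ c₁ = true → cellsOK d ord L₂ c₂ = true → cellsOK d ord (L₁ ++ L₂) (c₁ ++ c₂) = true
  | [], [], L₂, c₂, _, _, h₂ => by simpa using h₂
  | [], _ :: _, _, _, h, _, _ => by simp at h
  | _ :: _, [], _, _, h, _, _ => by simp at h
  | (s, m) :: L₁, ct :: c₁, L₂, c₂, h, h₁, h₂ => by
    simp only [cellsOK, Bool.and_eq_true] at h₁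
    simp only [List.cons_append, cellsOK, Bool.and_eq_true]
    exact ⟨h₁.1, cellsOK_append d ord L₁ c₁ L₂ c₂ (by simpa using h) h₁.2 h₂⟩

/-- **A slice from two pieces**: if both pieces pass `V19S.checkCells` then so does their concatenation (stated with the concatenations as
separate arguments so that a data file can name the slice literally). [folklore] -/
theorem checkCells_of_halves {d : List ℕ} {L₁ L₂ L : List (Bool × Mode)} {c₁ c₂ c : List Cert}
    (h₁ : checkCells d L₁ c₁ = true) (h₂ : checkCells d L₂ c₂ = true) (hlen : L₁.length = c₁.length)
    (hL : L₁ ++ L₂ = L) (hc : c₁ ++ c₂ = c) : checkCells d L c = true := by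
  subst hL hc
  unfold checkCells at h₁ h₂ ⊢
  simp only [Bool.and_eq_true] at h₁ h₂ ⊢
  exact ⟨h₁.1, cellsOK_append d (sortAtoms d) L₁ c₁ L₂ c₂ hlen h₁.2 h₂.2⟩

end Summit.ValiantsHypothesis.ValiantsHypothesis.Theorems.LacunarySymmetroidMatrixDescartes.Census.V19S
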